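import Literature.AlgebraicGeometry.Frobenioids.BirationalizationCoAngularGeneral
import HarnessLib

/-!
# Frobenioids I, Proposition 4.4 (ii) (2024 form) for a GENERAL Frobenioid: Def. 1.3 (ii), (iv), (v)(a)
# for `C^birat` without isotropy

Mochizuki, *The geometry of Frobenioids I: the general theory*, Kyushu J. Math. **62** (2008)
293–400, §4, Proposition 4.4 (ii), kurims text p. 83, in the author's corrected form (*Comments* (2024)
(29)(i)): "Suppose, further, that `C` is of birationally Frobenius-normalized type. Then the
pre-Frobenioid `C^birat` is a Frobenioid" [cite: MochizukiFrdI2008, Prop. 4.4 (ii) p.83]. This file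
(seat abc-iut-L6-t20, row W14 STAGE 2 of the abc-iut cell) removes the ISOTROPY hypothesis of
`BirationalizationPullbackFactorization.lean` from the clauses (ii) and (iv) of Def. 1.3
[cite: MochizukiFrdI2008, Def. 1.3 p.24] for `Birat.toElemZero hF hsq : C^birat ⥤ F_{0_D}`, and adds
(v)(a):

* `ii_exists'`, `ii_unique'` — morphisms of Frobenius type of prescribed degree exist (images) and are
  essentially unique: over a common denominator the numerators are CO-ANGULAR base-isomorphisms of `C`
  (`isCoAngular_homMk_iff`), so in their factorisations "Frobenius type, then a pre-step" the pre-steps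
  are co-angular (Prop. 1.4 (iv), `isCoAngular_iff_of_factorization`), hence invertible in `C^birat`;
* `exists_frobeniusType_preStep_pullback` — every `[(α, φ′)]` is `(α⁻¹ γ b)^birat ≫ ι^birat ≫ a^birat`
  for `φ′ = a ∘ ι ∘ b ∘ γ` (Def. 1.3 (iv)(a), then (v)(b) on the pre-step, in `C`): Frobenius type,
  pre-step, pull-back (the last one linear and co-angular);
* `iv_a_exists'`, `iv_a_unique'` (uniqueness: the pull-back property of `α′` produces `δ`, Def. 1.3 (ii)
  of `C^birat` produces `ε`, and `γ` is an epimorphism), `iv_b'`;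
* `v_a'` — pre-steps of `C^birat` are monomorphisms (`C → C^birat` preserves monomorphisms).

Hypotheses: `hF`, `hsq` only (no isotropy, no normalization). PROOF-ONLY file. No statement of the paper
is strengthened; nothing here concerns the disputed parts of IUT.
-/

namespace Literature.AlgebraicGeometry.Frobenioids

open CategoryTheory Opposite

universe w v v' u u'

namespace PreFrobenioid

variable {D : Type u} [Category.{v} D] {Φ : Dᵒᵖ ⥤ CommMonCat.{w}}
  {C : Type u'} [Category.{v'} C] {F : C ⥤ ElemFrobenioid Φ}
  {hF : IsFrobenioid F} {hsq : HasBiratSquares F}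

namespace Birat

/-! ### Def. 1.3 (i)(a), (ii) -/

/-- **Def. 1.3 (i)(a) for `C^birat`**, every Frobenioid `C`: Frobenius-trivial objects over every base
(images of those of `C`). [cite: MochizukiFrdI2008, Prop. 4.4 (ii) p.83] -/
theorem i_a' (A₀ : D) :
    ∃ X : Birat F hF hsq, IsFrobeniusTrivial (toElemZero hF hsq) X ∧
      Nonempty (baseObj (toElemZero hF hsq) X ≅ A₀) := by
  obtain ⟨A, hA, ⟨e⟩⟩ := hF.i_a A₀
  exact ⟨(toBirat F hF hsq).obj A, isFrobeniusTrivial_toBirat_obj hA, ⟨e⟩⟩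

/-- **Def. 1.3 (ii) for `C^birat`, existence**, every Frobenioid `C`: the image of a morphism of
Frobenius type of degree `n` is one. [cite: MochizukiFrdI2008, Prop. 4.4 (ii) p.83] -/
theorem ii_exists' (X : Birat F hF hsq) (n : ℕ+) :
    ∃ (Y : Birat F hF hsq) (φ : X ⟶ Y), IsFrobeniusType (toElemZero hF hsq) φ ∧
      degFr (toElemZero hF hsq) φ = n := by
  obtain ⟨B, φ, hφ, hd⟩ := hF.ii_exists X.out n
  exact ⟨(toBirat F hF hsq).obj B, (toBirat F hF hsq).map φ, isFrobeniusType_toElemZero_map hφ, hd⟩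

/-- **Def. 1.3 (ii) for `C^birat`, essential uniqueness**, every Frobenioid `C`. As in the isotropic case
(`ii_unique`), except that the invertibility in `C^birat` of the pre-steps `βᵢ` of the factorisations
`κ ≫ φ′ = γ₁ ≫ β₁`, `κ′ ≫ ψ′ = γ₂ ≫ β₂` now comes from their CO-ANGULARITY: the numerators of
morphisms of Frobenius type are co-angular in `C`, and Prop. 1.4 (iv) transfers co-angularity to the
pre-step of a "Frobenius type ∘ pre-step" factorisation. [cite: MochizukiFrdI2008, Prop. 4.4 (ii) p.83] -/
theorem ii_unique' ⦃X Y Y' : Birat F hF hsq⦄ (φ : X ⟶ Y) (ψ : X ⟶ Y')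
    (hφ : IsFrobeniusType (toElemZero hF hsq) φ) (hψ : IsFrobeniusType (toElemZero hF hsq) ψ)
    (hd : degFr (toElemZero hF hsq) φ = degFr (toElemZero hF hsq) ψ) :
    ∃ β : Y ≅ Y', φ ≫ β.hom = ψ := by
  obtain ⟨f, rfl⟩ := homMk_surjective φ
  obtain ⟨g, rfl⟩ := homMk_surjective ψ
  have hfco : IsCoAngular F f.num := (isCoAngular_homMk_iff' f).mp hφ.1.1
  have hgco : IsCoAngular F g.num := (isCoAngular_homMk_iff' g).mp hψ.1.1
  obtain ⟨E, κ, κ', hκ, hκ', hE⟩ := exists_common_refinement hF f.den g.den f.den_mem g.den_mem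
  haveI := toBirat_inverts hF hsq (κ ≫ f.den) (hκ.comp hF f.den_mem)
  have hn₁ : IsBaseIso F (κ ≫ f.num) := IsBaseIso.comp F hκ.2.2 (isBaseIso_num f hφ.2)
  have hn₂ : IsBaseIso F (κ' ≫ g.num) := IsBaseIso.comp F hκ'.2.2 (isBaseIso_num g hψ.2)
  have hn₁co : IsCoAngular F (κ ≫ f.num) := hF.iii_a κ f.num hκ.1 hfco
  have hn₂co : IsCoAngular F (κ' ≫ g.num) := hF.iii_a κ' g.num hκ'.1 hgco
  have hd' : degFr F f.num = degFr F g.num := hd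
  obtain ⟨X₁, γ₁, β₁, hfac₁, hγ₁, hβ₁⟩ :=
    (isBaseIso_iff_exists_frobeniusType_preStep F hF (κ ≫ f.num)).mp hn₁
  obtain ⟨X₂, γ₂, β₂, hfac₂, hγ₂, hβ₂⟩ :=
    (isBaseIso_iff_exists_frobeniusType_preStep F hF (κ' ≫ g.num)).mp hn₂
  -- the pre-steps `βᵢ` are co-angular (Prop. 1.4 (iv) with trivial pull-back part)
  have hβ₁co : IsCoAngularPreStep F β₁ :=
    ⟨(isCoAngular_iff_of_factorization F hF (κ ≫ f.num) γ₁ β₁ (𝟙 _)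
      (by rw [Category.comp_id, hfac₁]) hγ₁ hβ₁ (isPullbackMorphism_of_isIso F _)).mp hn₁co, hβ₁⟩
  have hβ₂co : IsCoAngularPreStep F β₂ :=
    ⟨(isCoAngular_iff_of_factorization F hF (κ' ≫ g.num) γ₂ β₂ (𝟙 _)
      (by rw [Category.comp_id, hfac₂]) hγ₂ hβ₂ (isPullbackMorphism_of_isIso F _)).mp hn₂co, hβ₂⟩
  have hdγ : degFr F γ₁ = degFr F γ₂ := by
    have e₁ := degFr_comp F γ₁ β₁
    have e₂ := degFr_comp F γ₂ β₂
    rw [hfac₁, degFr_comp, show degFr F κ = 1 from hκ.2.1, show degFr F β₁ = 1 from hβ₁.1, one_mul,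
      mul_one] at e₁
    rw [hfac₂, degFr_comp, show degFr F κ' = 1 from hκ'.2.1, show degFr F β₂ = 1 from hβ₂.1,
      one_mul, mul_one] at e₂
    rw [← e₁, ← e₂, hd']
  obtain ⟨ε, hε⟩ := hF.ii_unique γ₁ γ₂ hγ₁ hγ₂ hdγ
  haveI := toBirat_inverts hF hsq β₁ hβ₁co
  haveI := toBirat_inverts hF hsq β₂ hβ₂co
  have rhs : (toBirat F hF hsq).map (κ ≫ f.den) ≫
      (homMk g : (toBirat F hF hsq).obj X.out ⟶ (toBirat F hF hsq).obj Y'.out) =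
      (toBirat F hF hsq).map (κ' ≫ g.num) := by
    rw [hE]
    exact toBirat_map_comp_den_comp_homMk g κ'
  have key : (homMk f : (toBirat F hF hsq).obj X.out ⟶ (toBirat F hF hsq).obj Y.out) ≫
      (inv ((toBirat F hF hsq).map β₁) ≫ (toBirat F hF hsq).map ε.hom ≫ (toBirat F hF hsq).map β₂) =
      (homMk g : (toBirat F hF hsq).obj X.out ⟶ (toBirat F hF hsq).obj Y'.out) := by
    rw [← cancel_epi ((toBirat F hF hsq).map (κ ≫ f.den)), ← Category.assoc,
      toBirat_map_comp_den_comp_homMk f κ, rhs, ← hfac₁, ← hfac₂, ← hε, Functor.map_comp,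
      Functor.map_comp, Functor.map_comp, Category.assoc, IsIso.hom_inv_id_assoc, Category.assoc]
  exact ⟨asIso (X := (toBirat F hF hsq).obj Y.out) (Y := (toBirat F hF hsq).obj Y'.out)
    (inv ((toBirat F hF hsq).map β₁) ≫ (toBirat F hF hsq).map ε.hom ≫ (toBirat F hF hsq).map β₂), key⟩

/-! ### Def. 1.3 (iv) -/

/-- **The factorisation of Def. 1.3 (iv)(a) in `C^birat`**, every Frobenioid `C`: `[(α, φ′)]` equals
`(α^birat)⁻¹ ≫ γ^birat ≫ b^birat` (of Frobenius type), then `ι^birat` (a pre-step), then `a^birat` (a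
linear, co-angular pull-back morphism), where `φ′ = a ∘ β ∘ γ` is the factorisation of Def. 1.3 (iv)(a) in
`C` and `β = ι ∘ b` that of Def. 1.3 (v)(b) (`b` a co-angular pre-step — invertible in `C^birat` — and `ι`
an isometric pre-step). [cite: MochizukiFrdI2008, Prop. 4.4 (ii) p.83] -/
theorem exists_frobeniusType_preStep_pullback ⦃X Y : Birat F hF hsq⦄ (φ : X ⟶ Y) :
    ∃ (X' Y' : Birat F hF hsq) (γ : X ⟶ X') (β : X' ⟶ Y') (α : Y' ⟶ Y), γ ≫ β ≫ α = φ ∧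
      IsFrobeniusType (toElemZero hF hsq) γ ∧ IsPreStep (toElemZero hF hsq) β ∧
      IsPullbackMorphism (toElemZero hF hsq) α ∧ IsLinear (toElemZero hF hsq) α ∧
      IsCoAngular (toElemZero hF hsq) α := by
  obtain ⟨f, rfl⟩ := homMk_surjective φ
  obtain ⟨P, Q, γ, β, a, hfac, hγ, hβ, ha⟩ := hF.iv_a_exists f.num
  obtain ⟨R, b, ι, hbι, hb, hι⟩ := hF.v_b_exists β hβ
  haveI := toBirat_inverts hF hsq f.den f.den_mem
  haveI := toBirat_inverts hF hsq b hb
  have key : (inv ((toBirat F hF hsq).map f.den) ≫ (toBirat F hF hsq).map γ ≫ (toBirat F hF hsq).map b) ≫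
      (toBirat F hF hsq).map ι ≫ (toBirat F hF hsq).map a =
      (homMk f : (toBirat F hF hsq).obj X.out ⟶ (toBirat F hF hsq).obj Y.out) := by
    rw [homMk_eq_inv_comp f, ← hfac, ← hbι]
    simp only [Functor.map_comp, Category.assoc]
  have hγ' : IsFrobeniusType (toElemZero hF hsq)
      (inv ((toBirat F hF hsq).map f.den) ≫ (toBirat F hF hsq).map γ ≫ (toBirat F hF hsq).map b :
        (toBirat F hF hsq).obj X.out ⟶ (toBirat F hF hsq).obj R) :=
    ⟨⟨((isCoAngular_toElemZero_map hγ.1.1).comp_iso ((toBirat F hF hsq).map b)).iso_comp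
        (inv ((toBirat F hF hsq).map f.den)), isIsometry_toElemZero _⟩,
      IsBaseIso.comp (toElemZero hF hsq) (isBaseIso_of_isIso (toElemZero hF hsq) _)
        (IsBaseIso.comp (toElemZero hF hsq) (isBaseIso_toElemZero_map hγ.2)
          (isBaseIso_toElemZero_map hb.2.2))⟩
  exact ⟨(toBirat F hF hsq).obj R, (toBirat F hF hsq).obj Q, _, ((toBirat F hF hsq).map ι :
      (toBirat F hF hsq).obj R ⟶ (toBirat F hF hsq).obj Q),
    ((toBirat F hF hsq).map a : (toBirat F hF hsq).obj Q ⟶ (toBirat F hF hsq).obj Y.out), key, hγ',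
    isPreStep_toBirat_map hι.2, (isPullbackMorphism_toElemZero_iff _).mpr (isPullbackMorphism_toBirat_map ha),
    (isLinear_toBirat_map_iff a).mpr (hF.iv_b a ha).2, isCoAngular_toElemZero_map (hF.iv_b a ha).1.1⟩

/-- **Def. 1.3 (iv)(a) for `C^birat`, existence**, every Frobenioid `C`.
[cite: MochizukiFrdI2008, Prop. 4.4 (ii) p.83] -/
theorem iv_a_exists' ⦃X Y : Birat F hF hsq⦄ (φ : X ⟶ Y) :
    ∃ (X' Y' : Birat F hF hsq) (γ : X ⟶ X') (β : X' ⟶ Y') (α : Y' ⟶ Y), γ ≫ β ≫ α = φ ∧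
      IsFrobeniusType (toElemZero hF hsq) γ ∧ IsPreStep (toElemZero hF hsq) β ∧
      IsPullbackMorphism (toElemZero hF hsq) α := by
  obtain ⟨X', Y', γ, β, α, h, hγ, hβ, hα, -, -⟩ := exists_frobeniusType_preStep_pullback φ
  exact ⟨X', Y', γ, β, α, h, hγ, hβ, hα⟩

/-- **Def. 1.3 (iv)(a) for `C^birat`, uniqueness**, every Frobenioid `C`: for two factorisations
`α ∘ β ∘ γ = α′ ∘ β′ ∘ γ′` the pull-back property of `α′` lifts `Base(β ∘ γ)⁻¹ ≫ Base(β′ ∘ γ′)` to an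
isomorphism `δ : Y ⥲ Y′` with `α = α′ ∘ δ` and `δ ∘ β ∘ γ = β′ ∘ γ′`; then `γ`, `γ′` are of Frobenius
type of the same degree, so Def. 1.3 (ii) of `C^birat` (`ii_unique'`) gives `ε` with `ε ∘ γ = γ′`, and
`δ ∘ β = β′ ∘ ε` because `γ` is an epimorphism. [cite: MochizukiFrdI2008, Prop. 4.4 (ii) p.83] -/
theorem iv_a_unique' ⦃A B X Y X' Y' : Birat F hF hsq⦄ (φ : A ⟶ B)
    (γ : A ⟶ X) (β : X ⟶ Y) (α : Y ⟶ B) (γ' : A ⟶ X') (β' : X' ⟶ Y') (α' : Y' ⟶ B)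
    (h : γ ≫ β ≫ α = φ) (hγ : IsFrobeniusType (toElemZero hF hsq) γ)
    (hβ : IsPreStep (toElemZero hF hsq) β) (hα : IsPullbackMorphism (toElemZero hF hsq) α)
    (h' : γ' ≫ β' ≫ α' = φ) (hγ' : IsFrobeniusType (toElemZero hF hsq) γ')
    (hβ' : IsPreStep (toElemZero hF hsq) β') (hα' : IsPullbackMorphism (toElemZero hF hsq) α') :
    ∃ (ε : X ≅ X') (δ : Y ≅ Y'), γ ≫ ε.hom = γ' ∧ β ≫ δ.hom = ε.hom ≫ β' ∧ α = δ.hom ≫ α' := by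
  have hb : IsBaseIso (toElemZero hF hsq) (γ ≫ β) := IsBaseIso.comp _ hγ.2 hβ.2
  have hb' : IsBaseIso (toElemZero hF hsq) (γ' ≫ β') := IsBaseIso.comp _ hγ'.2 hβ'.2
  haveI : IsIso (Base (toElemZero hF hsq) (γ ≫ β)) := hb
  haveI : IsIso (Base (toElemZero hF hsq) (γ' ≫ β')) := hb'
  let k : baseObj (toElemZero hF hsq) Y ⟶ baseObj (toElemZero hF hsq) Y' :=
    inv (Base (toElemZero hF hsq) (γ ≫ β)) ≫ Base (toElemZero hF hsq) (γ' ≫ β')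
  have hφ : Base (toElemZero hF hsq) (γ ≫ β) ≫ Base (toElemZero hF hsq) α =
      Base (toElemZero hF hsq) (γ' ≫ β') ≫ Base (toElemZero hF hsq) α' := by
    rw [← base_comp, ← base_comp, Category.assoc, Category.assoc, h, h']
  have hk : Base (toElemZero hF hsq) α = k ≫ Base (toElemZero hF hsq) α' := by
    rw [Category.assoc, ← hφ, IsIso.inv_hom_id_assoc]
  obtain ⟨δ, hδ⟩ := (hα' Y).2 ⟨(α, k), hk⟩
  have hδ₁ : δ ≫ α' = α :=
    congrArg (fun p : PullbackHomData (toElemZero hF hsq) α' Y => p.1.1) hδ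
  have hδ₂ : Base (toElemZero hF hsq) δ = k :=
    congrArg (fun p : PullbackHomData (toElemZero hF hsq) α' Y => p.1.2) hδ
  have hδpb : IsPullbackMorphism (toElemZero hF hsq) δ :=
    IsPullbackMorphism.of_comp (toElemZero hF hsq) hα' (by rw [hδ₁]; exact hα)
  have hδbi : IsBaseIso (toElemZero hF hsq) δ := by
    change IsIso (Base (toElemZero hF hsq) δ)
    rw [hδ₂]
    infer_instance
  haveI : IsIso δ := (isPullbackMorphism_and_isBaseIso_iff_isIso (toElemZero hF hsq) δ).mp ⟨hδpb, hδbi⟩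
  have hγβδ : (γ ≫ β) ≫ δ = γ' ≫ β' := by
    apply (hα' A).1
    apply Subtype.ext
    apply Prod.ext
    · change ((γ ≫ β) ≫ δ) ≫ α' = (γ' ≫ β') ≫ α'
      rw [Category.assoc, hδ₁, Category.assoc, h, Category.assoc, h']
    · change Base (toElemZero hF hsq) ((γ ≫ β) ≫ δ) = Base (toElemZero hF hsq) (γ' ≫ β')
      rw [base_comp, hδ₂, IsIso.hom_inv_id_assoc]
  -- degrees of `γ`, `γ′` agree
  have hdeg : degFr (toElemZero hF hsq) γ = degFr (toElemZero hF hsq) γ' := by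
    have e := congrArg (degFr (toElemZero hF hsq)) hγβδ
    rw [degFr_comp, degFr_comp, degFr_comp, show degFr (toElemZero hF hsq) β = 1 from hβ.1,
      show degFr (toElemZero hF hsq) β' = 1 from hβ'.1,
      show degFr (toElemZero hF hsq) δ = 1 from isLinear_of_isIso (toElemZero hF hsq) δ,
      mul_one, mul_one, mul_one] at e
    exact e
  obtain ⟨ε, hε⟩ := ii_unique' γ γ' hγ hγ' hdeg
  refine ⟨ε, asIso δ, hε, ?_, by rw [asIso_hom, hδ₁]⟩
  haveI : Epi γ := (isTotallyEpimorphic hF hsq).epi γ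
  rw [asIso_hom, ← cancel_epi γ, ← Category.assoc, hγβδ, ← Category.assoc, hε]

/-- **Def. 1.3 (iv)(b) for `C^birat`**, every Frobenioid `C`: a pull-back morphism `φ` of `C^birat` is
LB-invertible and linear — writing `φ = u ≫ a^birat` (`exists_frobeniusType_preStep_pullback`: `u` of
Frobenius type followed by a pre-step, `a` a pull-back morphism of `C`), `u` is a pull-back morphism
(two-out-of-three) and a base-isomorphism, hence an isomorphism, and `a^birat` is linear and co-angular.
[cite: MochizukiFrdI2008, Prop. 4.4 (ii) p.83] -/
theorem iv_b' ⦃X Y : Birat F hF hsq⦄ (φ : X ⟶ Y) (hφ : IsPullbackMorphism (toElemZero hF hsq) φ) :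
    IsLBInvertible (toElemZero hF hsq) φ ∧ IsLinear (toElemZero hF hsq) φ := by
  obtain ⟨X', Y', γ, β, α, h, hγ, hβ, hα, hlin, hco⟩ := exists_frobeniusType_preStep_pullback φ
  have hupb : IsPullbackMorphism (toElemZero hF hsq) (γ ≫ β) :=
    IsPullbackMorphism.of_comp (toElemZero hF hsq) hα (by rw [Category.assoc, h]; exact hφ)
  have hub : IsBaseIso (toElemZero hF hsq) (γ ≫ β) := IsBaseIso.comp _ hγ.2 hβ.2
  haveI : IsIso (γ ≫ β) :=
    (isPullbackMorphism_and_isBaseIso_iff_isIso (toElemZero hF hsq) (γ ≫ β)).mp ⟨hupb, hub⟩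
  have e : (γ ≫ β) ≫ α = φ := by rw [Category.assoc, h]
  refine ⟨⟨?_, isIsometry_toElemZero φ⟩, ?_⟩
  · rw [← e]
    exact hco.iso_comp (γ ≫ β)
  · change degFr (toElemZero hF hsq) φ = 1
    rw [← e, degFr_comp, show degFr (toElemZero hF hsq) α = 1 from hlin, mul_one]
    exact isLinear_of_isIso (toElemZero hF hsq) (γ ≫ β)

/-! ### Def. 1.3 (v)(a) -/

/-- **Def. 1.3 (v)(a) for `C^birat`**, every Frobenioid `C`: a pre-step `[(α, φ′)] = (α^birat)⁻¹ ≫ φ′^birat`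
is a monomorphism, `φ′` being a pre-step of `C` (a monomorphism, Def. 1.3 (v)(a)) and `C → C^birat`
preserving monomorphisms. [cite: MochizukiFrdI2008, Prop. 4.4 (ii) p.83] -/
theorem v_a' ⦃X Y : Birat F hF hsq⦄ (ψ : X ⟶ Y) (hψ : IsPreStep (toElemZero hF hsq) ψ) : Mono ψ := by
  obtain ⟨f, rfl⟩ := homMk_surjective ψ
  haveI : Mono f.num := hF.v_a f.num (isPreStep_num f hψ)
  haveI := mono_toBirat_map (hF := hF) (hsq := hsq) f.num
  haveI := toBirat_inverts hF hsq f.den f.den_mem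
  have key : @Mono (Birat F hF hsq) _ ((toBirat F hF hsq).obj X.out) ((toBirat F hF hsq).obj Y.out)
      (homMk f) := by
    rw [homMk_eq_inv_comp f]
    infer_instance
  exact key

end Birat

end PreFrobenioid

end Literature.AlgebraicGeometry.Frobenioids
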